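import Summits.BirchSwinnertonDyer.BirchSwinnertonDyer.Theorems.PrintCf2RamifiedOffTYZGaloisMotionDoor
import Summits.BirchSwinnertonDyer.Rank1Residual.P2.CongruentNumberPairsAtTwoDoorAAtlasThree
import Literature.NumberTheory.EllipticCurves.CongruentNumberOddMonskySelmerExact
import HarnessLib

/-!
# Route `PrintCf2`, crux stmt-BirchSwinnertonDyer-20509 `RamifiedOffTYZOfFacts` — the Galois-mover door at `ω(n) = 3`: the
# EXCEPTIONAL CLASS-5 CONFIGURATION `p₅·q₇·r₇`, `(q/p) = (r/p) = −1` (where TYZ Thm 1.2 is silent and the cell's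
# `…three_primes_five` claims nothing) is closed MODULO a certified Galois mover of the genus point
# (cell `bsd-print-cf2`, LEAD of 20509 g4, line `offtyz-v7`, lineage cycle 5, sequel of `…GaloisMotionDoor`; fact-free, no `def`)

HONEST FRAMING.  `Rank1Residual/P2/CongruentNumberPairsAtTwoDoorAAtlasThree.lean` proves, modulo `hTYZ`, `hGZK`, `hM`, `hR`, that for
three distinct primes with `p₀p₁p₂ ≡ 5 (mod 8)` and Monsky kernel `2` (`s(n) = 1`), `BSD(E_n, 2)` holds OFF the exceptional
configuration `exceptionalFiveCfg` = «one prime `≡ 5`, the other two `≡ 7 (mod 8)`, both symbols `(q/p) = −1`», on which «NOTHING is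
claimed (there `Σ₁`, `Σ₂′` are even and TYZ Thm 1.2 is silent)».  The LEAD note (`Cruxes/…/Lines/offtyz_v7_TransferLayer.md` §6, §10;
tables `…_tables.md`) shows that EXACTLY there the transfer layer supplies a Galois mover of the genus point: `e₄(−4n) = 1` and the square
ambiguous class of `Cl(ℚ(√−n))` contains `𝔭₂`, so an element of `Gal(H′_n/L_n)` has `g(n)`-th power `σ` and moves `Z(n)` — hence
`P(n)`, the lower terms of the recursion being fixed (`𝓛(qr)` even, `Z(q), Z(r)` over `L`).  THIS FILE is the kernel statement that
such a mover closes the configuration: Monsky's theorem is a THEOREM of the tree (`monsky_card_selmerGroup_two_odd_holds`), so from a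
`2`-element Monsky kernel and a mover one gets `ord = rank = 1`, `Ш[2^∞] = 0`, `BSD(E_n, 2)` — with NO `hGZK`, NO `hM`, NO `hR` and no
genus parity; the only non-displayed input is the mover itself (class field theory of `ℚ(√−n)`: the identification
`Gal(H′_n/K_n) ≅ Pic(O₂)` and the 𝔭₂-law are not typed — see the note §8).  Nothing is asserted; BSD is not proved by any of this; no
class is closed unconditionally.

* `rankOne_sha_bsdp_two_congruentNumberCurve_three_primes_of_card_ker_of_mover` — any three distinct odd primes with `n ≡ 5, 7 (mod 8)`,
  Monsky kernel `2`, data `D` with the displays, a mover ⟹ the four conclusions.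
* `…_of_mover_of_tyz` — keyed on `tyz_genusPointData` (mover quantified over the printed data).
* `forall_bsdp_two_congruentNumberCurve_three_primes_of_mover` — the `∀`-form on `monskySelmerRankOdd p = 1`.

References: [cite: TianYuanZhang2017, Thm. 3.5 (p0011 L94–L100), Lemma 3.18]; [cite: HeathBrown1994SelmerCongruentII, Appendix (Monsky),
typescript p. 39 L10–L33]; [cite: Miller2011LMS, Def. 1.1]; tree: `…GaloisMotionDoor` (p672160), `…PairsAtTwoDoorAAtlasThree`
(`exceptionalFiveCfg`, `monskySelmerRankOdd_eq_one_iff_card_ker`), `CongruentNumberOddMonskySelmerExact` (Monsky's theorem, proved).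
-/

noncomputable section

open scoped Classical

open Matrix Finset WeierstrassCurve Literature.NumberTheory.EllipticCurves
  Literature.NumberTheory.EllipticCurves.Rank1Residual Summit.BirchSwinnertonDyer.Rank1Residual
  Literature.NumberTheory.EllipticCurves.HeathBrown1994
  Literature.NumberTheory.EllipticCurves.TianYuanZhang2017

set_option autoImplicit false

namespace Summit.BirchSwinnertonDyer.PrintCf2.GaloisMotion

variable (p : Fin 3 → ℕ)

/-- Each prime of an odd product is odd. [folklore] -/
theorem odd_of_prod_three_odd (hp : ∀ i, (p i).Prime) {n : ℕ} (hn : ∏ i, p i = n) (hodd : Odd n) (i : Fin 3) :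
    Odd (p i) := by
  rcases (hp i).eq_two_or_odd' with h2 | h
  · exfalso
    have hdvd : p i ∣ n := hn ▸ Finset.dvd_prod_of_mem p (Finset.mem_univ i)
    rw [h2] at hdvd
    exact (Nat.not_even_iff_odd.mpr hodd) (even_iff_two_dvd.mpr hdvd)
  · exact h

/-- **THREE PRIMES, MONSKY KERNEL `2`, A MOVER ⟹ `BSD(E_n, 2)`.**  Distinct primes `p₀, p₁, p₂`, `n = p₀p₁p₂ ≡ 5, 7 (mod 8)`, Monsky's
matrix with a `2`-element kernel (`s(n) = 1`, so `#Sel⁽²⁾(E_n/ℚ) = 8` by Monsky's theorem PROVED in the tree), `D : GenusPointData n` with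
Thm 3.5's main clause, integrality and Lemma 3.18, and an automorphism `g` of `ℍ′_n` fixing `i` and every `√−d` (`d ∣ n`) that moves `P(n)`:
then `ord_{s=1} L(E_n, s) = 1`, `rank E_n(ℚ) = 1`, `Ш(E_n)[2^∞] = 0`, `BSD(E_n, 2)`.  Covers the exceptional class-5 configuration
`p₅·q₇·r₇`, `(q/p) = (r/p) = −1` of `…three_primes_five` once the mover is certified.
[cite: TianYuanZhang2017, Thm. 3.5 and Lemma 3.18] [cite: HeathBrown1994SelmerCongruentII, Appendix (Monsky), typescript p. 39 L33]
[cite: Miller2011LMS, Def. 1.1 (arXiv:1010.2431 p. 3)] -/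
theorem rankOne_sha_bsdp_two_congruentNumberCurve_three_primes_of_card_ker_of_mover
    (hp : ∀ i, (p i).Prime) (hinj : Function.Injective p) {n : ℕ} (hn : ∏ i, p i = n)
    (h8 : n % 8 = 5 ∨ n % 8 = 7)
    (hker : Fintype.card {v : Fin 3 ⊕ Fin 3 → ZMod 2 // monskyMatrixOdd p *ᵥ v = 0} = 2)
    (D : GenusPointData n) (h35 : D.thm35Main) (hLs : D.scriptLSpec) (h318 : D.lemma318)
    (g : D.H ≃ₐ[ℚ] D.H) (hgi : g D.im = D.im) (hgd : ∀ d ∈ n.divisors, g (D.sqrtNeg d) = D.sqrtNeg d)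
    (hmove : D.galPt g (D.P n) ≠ D.P n) :
    haveI := isElliptic_congruentNumberCurve (hn ▸ (squarefree_prod_of_injective p hp hinj).ne_zero)
    (congruentNumberCurve n).analyticRank = 1 ∧ (congruentNumberCurve n).mordellWeilRank = 1 ∧
      AddCommGroup.primaryComponent (congruentNumberCurve n).sha 2 = ⊥ ∧
      BSDp (congruentNumberCurve n) 2 := by
  have hsq : Squarefree n := hn ▸ squarefree_prod_of_injective p hp hinj
  have hoddn : Odd n := by rcases h8 with h | h <;> exact Nat.odd_iff.mpr (by omega)
  have hodd : ∀ i, Odd (p i) := odd_of_prod_three_odd p hp hn hoddn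
  have hs : monskySelmerRankOdd p = 1 := (P2.monskySelmerRankOdd_eq_one_iff_card_ker p).mpr hker
  have hsel : Nat.card ((congruentNumberCurve n).selmerGroup 2) = 8 := by
    subst hn
    rw [monsky_card_selmerGroup_two_odd_holds 3 p hp hodd hinj, hs]
    norm_num
  exact rankOne_sha_bsdp_two_congruentNumberCurve_of_selmerEight_of_mover hsq h8 hsel D h35 hLs h318 g hgi hgd hmove

/-- The same, keyed on the named fact `tyz_genusPointData` (mover quantified over every printed datum).
[cite: TianYuanZhang2017, Thm. 3.5 and Lemma 3.18] [cite: HeathBrown1994SelmerCongruentII, Appendix (Monsky), typescript p. 39 L33]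
[cite: Miller2011LMS, Def. 1.1 (arXiv:1010.2431 p. 3)] -/
theorem rankOne_sha_bsdp_two_congruentNumberCurve_three_primes_of_card_ker_of_mover_of_tyz (hTYZ : tyz_genusPointData)
    (hp : ∀ i, (p i).Prime) (hinj : Function.Injective p) {n : ℕ} (hn : ∏ i, p i = n)
    (h8 : n % 8 = 5 ∨ n % 8 = 7)
    (hker : Fintype.card {v : Fin 3 ⊕ Fin 3 → ZMod 2 // monskyMatrixOdd p *ᵥ v = 0} = 2)
    (hmover : ∀ D : GenusPointData n, D.Printed →
      ∃ g : D.H ≃ₐ[ℚ] D.H, g D.im = D.im ∧ (∀ d ∈ n.divisors, g (D.sqrtNeg d) = D.sqrtNeg d) ∧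
        D.galPt g (D.P n) ≠ D.P n) :
    haveI := isElliptic_congruentNumberCurve (hn ▸ (squarefree_prod_of_injective p hp hinj).ne_zero)
    (congruentNumberCurve n).analyticRank = 1 ∧ (congruentNumberCurve n).mordellWeilRank = 1 ∧
      AddCommGroup.primaryComponent (congruentNumberCurve n).sha 2 = ⊥ ∧
      BSDp (congruentNumberCurve n) 2 := by
  have hsq : Squarefree n := hn ▸ squarefree_prod_of_injective p hp hinj
  have hoddn : Odd n := by rcases h8 with h | h <;> exact Nat.odd_iff.mpr (by omega)
  have hodd : ∀ i, Odd (p i) := odd_of_prod_three_odd p hp hn hoddn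
  have hs : monskySelmerRankOdd p = 1 := (P2.monskySelmerRankOdd_eq_one_iff_card_ker p).mpr hker
  have hsel : Nat.card ((congruentNumberCurve n).selmerGroup 2) = 8 := by
    subst hn
    rw [monsky_card_selmerGroup_two_odd_holds 3 p hp hodd hinj, hs]
    norm_num
  exact rankOne_sha_bsdp_two_congruentNumberCurve_of_selmerEight_of_mover_of_tyz hTYZ hsq h8 hsel hmover

/-- **`∀`-FORM: every `n = p₀p₁p₂ ≡ 5, 7 (mod 8)` with `s(n) = 1` (Monsky's `2k − rank M`) AND a certified Galois mover of the genus point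
satisfies `BSD(E_n, 2)`** — modulo `tyz_genusPointData` alone (no GZK, no Monsky fact, no Rédei–Reichardt, no genus parity).  Together with
`P2.rankOne_sha_bsdp_two_congruentNumberCurve_three_primes_five` / `…_seven` this leaves, at `ω(n) = 3` and `s(n) = 1`, only the mover
certificate on the exceptional class-5 configuration. [cite: TianYuanZhang2017, Thm. 3.5] [cite: HeathBrown1994SelmerCongruentII, Appendix (Monsky), typescript p. 39 L33]
[cite: Miller2011LMS, Def. 1.1 (arXiv:1010.2431 p. 3)] -/
theorem forall_bsdp_two_congruentNumberCurve_three_primes_of_mover (hTYZ : tyz_genusPointData) :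
    ∀ p : Fin 3 → ℕ, (∀ i, (p i).Prime) → Function.Injective p →
      ((∏ i, p i) % 8 = 5 ∨ (∏ i, p i) % 8 = 7) → monskySelmerRankOdd p = 1 →
      (∀ D : GenusPointData (∏ i, p i), D.Printed →
        ∃ g : D.H ≃ₐ[ℚ] D.H, g D.im = D.im ∧ (∀ d ∈ (∏ i, p i).divisors, g (D.sqrtNeg d) = D.sqrtNeg d) ∧
          D.galPt g (D.P (∏ i, p i)) ≠ D.P (∏ i, p i)) →
      BSDp (congruentNumberCurve (∏ i, p i)) 2 :=
  fun p hp hinj h8 hs hmover =>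
    (rankOne_sha_bsdp_two_congruentNumberCurve_three_primes_of_card_ker_of_mover_of_tyz p hTYZ hp hinj rfl h8
      ((P2.monskySelmerRankOdd_eq_one_iff_card_ker p).mp hs) hmover).2.2.2

end Summit.BirchSwinnertonDyer.PrintCf2.GaloisMotion

end
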